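import Mathlib
import Summits.NavierStokesRegularity.NavierStokesRegularity.Theorems.TaoLadderRungThreeRestartGlue
import Summits.NavierStokesRegularity.NavierStokesRegularity.Theses.CompletionRelayChain
import HarnessLib

/-!
# `CompletionRelayChain.RestartGlue` (item stmt-NavierStokesRegularity-24853; host support)

The support `RestartGlue` of route `CompletionRelayChain` is, character for character, the shared
support `RestartGlue` of routes `TaoLadderRungThree` / `HeteroclinicTriggerChain` /
`TrappingWindowRungThree` (items stmt-NavierStokesRegularity-20425 / 21751), already proved in
the tree as `Theorems.RestartGlue.epochCheckpoints_succ` (file `TaoLadderRungThreeRestartGlue.lean`):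
a `StepTo` of the flow restarted at checkpoint `(N, t_N, e_N)` is a level-`N+1`
`EpochCheckpoints` of the original family with `t_{N+1} = t_N + τ₁/γ`, `e_{N+1} = a · e_N`.
This file closes the new item by that theorem.

HONEST FRAMING: definitional bookkeeping about Tao-type MODEL lattice pseudo-flows (Tao 2016 §6);
nothing here is a statement about the Navier–Stokes equations, and the route's rung leaf
(`TaoLadderRungThree.TargetR64`, TL-M3-R64) is not the summit Statement.
-/

noncomputable section

set_option linter.dupNamespace false

namespace Summit.NavierStokesRegularity.NavierStokesRegularity.Theorems

open RestartGlue in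
/-- **Item stmt-NavierStokesRegularity-24853** (`CompletionRelayChain.RestartGlue`): a `StepTo`
of the restarted flow is a level-`N+1` `EpochCheckpoints` of the original family, closed by the
tree theorem `RestartGlue.epochCheckpoints_succ`.
[cite: Tao2016AveragedNS, §6.4 with §6.2 Prop. 6.3 (vi)–(ix)] -/
theorem completionRelayChain_restartGlue_proof :
    Summit.NavierStokesRegularity.NavierStokesRegularity.Theses.CompletionRelayChain.RestartGlue := by
  unfold Summit.NavierStokesRegularity.NavierStokesRegularity.Theses.CompletionRelayChain.RestartGlue
  intro ε₀ θ c m i₀ n₀ X₀ P Q N X E t e τ₁ a hε₀ hN h hst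
  exact epochCheckpoints_succ hε₀ hN h hst

end Summit.NavierStokesRegularity.NavierStokesRegularity.Theorems

end
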